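import Literature.MathematicalPhysics.QuantumFieldTheory.Balaban1983to89.B9Cor35GpCubeInputsAtOne
import Literature.MathematicalPhysics.QuantumFieldTheory.Balaban1983to89.B9CubeLettersBondOpsAtOneIdentL0
import Literature.MathematicalPhysics.QuantumFieldTheory.Balaban1983to89.B9Eq359CubeKernelsAtOne
import Literature.MathematicalPhysics.QuantumFieldTheory.Balaban1983to89.B9Ineq385VG

/-!
# `Balaban1983to89.B9Cor35GCubeInputsAtOne` — [B9] COROLLARY 3.5 p. 407 ∕ THEOREM 3.4's `G`-CLAUSE FOR THE BOND-SECTOR CUBE LETTER `G_□ = Δ_{a,□}⁻¹` OF SECT. C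
# p. 409, PART 1: THE `U = 1` INPUTS IN REAL COORDINATES (`Δa = conj b(Δ_{a,□}(1))`, `G = conj b(G_□(1))`, `Δa·G = 1 = G·Δa`, Theorem 3.3's (3.42)-type entries
# `G`, `∇_νG`, `ΔG` over the cube sequence's blocks — r05's `B9Thm33CubeAtOne` ∕ `B9CubeLettersBondOpsAtOneIdentL0` read through p33's realification), AND THE
# `G`-STEP (3.84)–(3.86) AT THESE LETTERS MODULO THE (3.85)-MAJORANT: `IsUnit Δ_{a,□}(Ṽ)`, `conj b(G_□(Ṽ))` = the Neumann inverse, transfer of every left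
# (3.42)-entry — r06's LETTER-FREE `B9Ineq385VG.exists_gExt_of_385` ∕ `gExt_leftEntry_of_386` instantiated (sub-row G-B9-LETTERS, module M5.1b-G, FILE G-F4)

T. Bałaban, *Propagators for lattice gauge theories in a background field*, Commun. Math. Phys. **99** (1985) 389–434
[`Balaban1985BackgroundPropagators`, "B9"]; [4] = T. Bałaban, *Propagators and renormalization transformations for lattice gauge theories. II*,
Commun. Math. Phys. **96** (1984) 223–250 [`Balaban1984PropagatorsII`].

statement-level skeleton of published theorems with citation tags; proofs where landed; nothing here is a claim about the
Yang–Mills mass gap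

THE PRINTED LOCUS (verbatim, held `paper:balaban1985-cmp99-background-propagators`, journal page = PDF page + 388; page owner r06).  Cor. 3.5 p. 407
l. 26–31: *«The theorems hold also for the operators (3.24), (3.25) … for U′ satisfying (3.37) with the same vector potentials and with U = 1, these theorems
were proved in [4]»*; Thm 3.4 p. 400: *«There exists a positive constant a₁ such that the operators G′(U), (Q′(U)G′²(U)Q′\*(U))⁻¹, R(U), G(U) extend to
configurations U′U for α₁ ≦ a₁ … The extended operators satisfy all the inequalities of Theorems 3.1-3.3 correspondingly»*; p. 407 (3.84)–(3.86): *«Δ_a(U′U) =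
Δ_a(U) − V(A) = (I − V(A)G(U))Δ_a(U) … |(V(A)G(U)J)(b)| ≦ O(1)α₁e^{−(1/2)δ₀d(y,y′)}|J| … (3.85) … hence V(A)G(U) is a small operator in supremum norm, and we have
G(U′U) = G(U)(I − V(A)G(U))⁻¹ = Σ_{n=0}^∞ G(U)(V(A)G(U))ⁿ, (3.86) … This way we get all these inequalities for the operator G(U′U), the local ones follow
from the bound (3.85) and Lemma 2.1 [4]»*; Thm 3.3 p. 399: *«the operator G(U) (a = 1) satisfies the inequalities (3.42)–(3.47), with G′(U) replaced by G(U)»*;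
(3.26)–(3.27) p. 395 (*«It coincides with Δ_a in (2.19) if U = 1»*, `G(U) = Δ_a(U)⁻¹`); p. 409 l. 1–5 (the cube operators `G_□(U)` *«satisfy all the inequalities
of Theorems 3.1–3.3»*).  [4] Prop. 2.6 (2.136) p. 247 (*«|G(b,b′)|, |(∇G)(b,b′)|, |(ΔG)(b,b′)| ≦ O(1)[…]e^{−δ₃d(y,y′)}»*), (2.51) p. 232 (block majorants),
Lemma 2.1 ∕ (2.66) p. 234.

WHY THIS FILE (cell `lit-balaban`, sub-row G-B9-LETTERS; module M5.1b-G = «Cor 3.5∕3.6 for the BOND-sector cube letter G_□», FILE G-F4 of the staged root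
`pub/ym-inputs/COR35G-STATEMENTS-p02.md` v1.4 §D; the bond twin of p33's F5b `B9Cor35GpCubeInputsAtOne`).  After G-F2∕G-F3 (p641389 ✓, p642457 ✓) the consumer's
per-cube inputs for the localised letter `O_□` are discharged up to TWO displayed items: `IsUnit Δ_{a,□}(Ṽ_□)` and the (3.42) block of `G_□(Ṽ_□)` — Cor. 3.5 for
the bond cube letter at the (3.37)-small field `Ṽ_□ = e^{iηχ̃_□A}·1`.  ROAD (recorded choice of this seat, g42): r06's CONCRETE-letter engine
`B9Thm34GUniformBlk.thm34_G_clause_uniform_blk` fixes `Δ_a`'s word in r06's own letters (`lapDDLetter + dPrimeLetter + gradLin∘(1 − P)∘divLin + Q*aQ`), whereas the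
consumer's cube letter is r05's `deltaACubeY = hessY + gradY∘R_□∘divY + Q*_□a_□Q_□` in def-Y's letters — no dictionary between the two Hessian formalisations
exists in the tree.  But r06 ALSO landed the `G`-step LETTER-FREE: `B9Ineq385VG.exists_gExt_of_385` ((3.84)–(3.86): from `Δa·G = 1 = G·Δa` and a (3.85)-majorant
`V·G ≺ θe^{−ρd}`, [4] Lemma 2.1 and `θc₁ < 1`, a two-sided inverse `GExt` of `Δa − V` with both resolvent identities) and `gExt_leftEntry_of_386` (every left
(3.42)-entry transfers, [4] (2.66)), with `B9Ineq385VG.ineq385_op` producing the (3.85)-majorant from (3.73)∕(3.77)∕(3.83)-SHAPED majorants of ABSTRACT pieces.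
THIS FILE instantiates that road at r05's cube letters realified by p33's `conj b` (S := the fine bonds `FBondY i`): PART 1 (§1–§2) = the `U = 1` inputs, PART 2
(§3) = the `G`-step modulo the (3.85)-majorant `h385` — so that FILE G-F5 has exactly ONE analytic target left: `h385` for
`V := conj b(Δ_{a,□}(1) − Δ_{a,□}(Ṽ_□))` (the Laplacian piece (3.69)–(3.73), the projection piece (3.74)–(3.77), the averaging piece (3.80)–(3.83) at r05's
letters, fed to `ineq385_op`).

WHAT THIS FILE PROVES (THEOREMS + eight `def`s∕`abbrev` with bodies: `blkBK`, `DaK`, `GK`, `DaVK`, `DK`, `LapK`, `GVK`, `VK`; 0 `def … : Prop`, 0 sorry).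
* §1 THE LETTERS (real coordinates, p33's `B9Eq352DivFormLetters.conj b`, carrier `FBondY i × ι`): the bond block map `blkBK i □` (= V1's `blkV1`: a bond sits in the
  cube block of its initial point), `DaK = conj b(Δ_{a,□}(1))`, `GK = conj b(G_□(1))`, `DaVK V = conj b(Δ_{a,□}(V))`, `DK ν = conj b(∇_ν)` (V1's `DV ν c_f` lifted —
  continuum units), `LapK = conj b(Δ)` (V1's `LapV c_f` lifted); ★ `DaK_mul_GK` (the binders `hΔG`, `hGΔ`: r05's `deltaACubeY_one_mul_GACubeY_one` ∕
  `GACubeY_one_mul_deltaACubeY_one`), `DaK_sub_remainder` ((3.84) bookkeeping: `Δa − conj b(Δ_{a,□}(1) − Δ_{a,□}(Ṽ)) = conj b(Δ_{a,□}(Ṽ))`), ★ `isUnit_deltaACubeY_of_laws`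
  (THE EXIT DOOR: a two-sided inverse of `conj b(Δ_{a,□}(Ṽ))` makes r05's `Δ_{a,□}(Ṽ)` a unit — p33's `B9Eq359CubeKernelsAtOne.isUnit_of_conj_laws` at scale 1).
* §2 THEOREM 3.3 AT `U = 1` REALIFIED: `pref_eq_len_sq` (V1's `(Lⁿ∕c_f)² = (Lⁿη)²`), `geomT_len_mul`, `GACubeY_one_restrict_liftY`; ★★ `hG_cube` (`GK ≺ A(Lⁿη)²e^{−δd}` over
  `toB6 (geoCK i □) Rr H` from V1's block majorant of `G_□(1)`), ★★ `hDG_cube ν` (`DK ν·GK ≺ A(Lⁿη)e^{−δd}`), ★★ `hLapG_cube` (`LapK·GK ≺ Ae^{−δd}`) — p33's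
  `hasMajorant_conj_of_liftY` + `hasMajorant_toB6_of_geomT` on r05's `GACubeY_one_liftY`; ★★★ `thm33_GK_cube` (`∃ σ₁ ∀ σ α ∃ A M₂ ∀ i □ Rr H b parS parB`, threshold
  `M₂ ≤ L·M_h`: the three majorants at the rate `δ₃ = delta3 α (2σ)` — r05's `thm33_cube_atOne_G` = [4] Prop. 2.6 (2.136) for the cube sequence).
* §3 `GVK V = conj b(G_□(V))`, `VK V = conj b(Δ_{a,□}(1) − Δ_{a,□}(V))`, `DaK_sub_VK`, `DaVK_mul_GVK`; ★★★ `gStep_cube` — for ANY background `V` (meant `Ṽ_□`): from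
  `h385 : VK V·GK ≺ θe^{−ρd}`, [4] (2.61) at `(ρ, α′)` over `toB6 (geoCK i □)` (p33's `exists_h261_geoCK` supplies it) and `θc₁(α′) < 1`: (i) `IsUnit (deltaACubeY i □
  parS parB V)`; (ii) both resolvent identities of (3.86) for `GVK V`; (iii) every left entry `X·GK ≺ B₀P(y)e^{−ρd}` transfers to `X·GVK V ≺ B₀c₁(α′)(1 −
  θc₁(α′))⁻¹P(y)e^{−(1−α′)ρd}` (`X = 1, DK ν, LapK` by §2 after rate weakening) — r06's `exists_gExt_of_385` + uniqueness of the two-sided inverse +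
  `gExt_leftEntry_of_386`.

HONEST SCOPE.  Bookkeeping over landed modules: r05's cube letters and their `U = 1` identification, the V1 lineage's [4] Prop. 2.6 at k levels, p33's
realification and geometry, r06's abstract (3.84)–(3.86) majorant calculus — all USED BY NAME; no estimate of [B9] is proved here beyond what those modules
prove.  The (3.85)-majorant `h385` for r05's letters is a HYPOTHESIS of §3 (FILE G-F5's target; print: (3.73), (3.77), (3.83) + Thm 3.3); [4] (2.61) and the
smallness `θc₁(α′) < 1` («for α₁ sufficiently small») are displayed; the transporter clauses `parS 1 = 1`, `parB 1 = 1` and `0 < b₀ ≤ b₁` are r05's.  Right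
(3.42)-entries (`G·∇*`) and the Hölder ∕ `L²` ∕ (3.47) members are NOT treated.  Count-neutral; NOT a node discharge; no summit ∕ sub-problem statement is
proved; nothing continuum ∕ OS ∕ mass-gap ∕ Clay; YM mass gap NOT proved by any of this (Track A conditional rung).  No `sorry`, no `axiom`, no `… : Prop`
fact, no `instance`, no `notation`.  NEW file; nothing landed is modified.  Cell `lit-balaban`, seat `lit-balaban-p38` gen 42, 2026-08-28; `--supports
stmt-QuantumFields-19200` as helper.
Net new unproved facts: 0.

RELATED IN THE TREE, NOT DUPLICATED (2026-08-28: `rg 'GCubeInputsAtOne|thm33_GK|gStep_cube'` over `Literature/` = ∅): p33's `B9Cor35GpCubeInputsAtOne` ∕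
`B9Cor35GpAtCubeLetters` (site sector, r06's concrete `thm34_Gp_uniform`); r06's `B9Thm34GUniformBlk` (concrete-letter `G`-clause, not instantiable at def-Y's
Hessian without a dictionary); ym-inputs-p02's `B9Thm311CubeLettersGSmallField` (`IsUnit Δ_{a,□}(U′)` in `L²` for `M_N(ℂ)`, unitary completely-small fields,
top level only, `σ` displayed — a different regime and currency; no decay).
-/

noncomputable section

namespace Literature.MathematicalPhysics.QuantumFieldTheory.Balaban1983to89.B9Cor35GCubeInputsAtOne

open Literature.MathematicalPhysics.QuantumFieldTheory.Balaban1983to89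
open Literature.MathematicalPhysics.QuantumFieldTheory.Balaban1983to89.B6RandomWalk (HasMajorant hasMajorant_mono delta3)
open Literature.MathematicalPhysics.QuantumFieldTheory.Balaban1983to89.B9Thm34Ext (toB6)
open Literature.MathematicalPhysics.QuantumFieldTheory.Balaban1983to89.B9Eq352DivFormLetters (conj)
open Literature.MathematicalPhysics.QuantumFieldTheory.Balaban1983to89.B6KLevelCensusIndexV1 (KIdx kGeo)
open Literature.MathematicalPhysics.QuantumFieldTheory.Balaban1983to89.B6Cover236MultiLevelBlocks (cubes)
open Literature.MathematicalPhysics.QuantumFieldTheory.Balaban1983to89.B6Ineq2133TwoScaleV1 (onFun)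
open Literature.MathematicalPhysics.QuantumFieldTheory.Balaban1983to89.B6SectAVectorModelV1 (GE)
open Literature.MathematicalPhysics.QuantumFieldTheory.Balaban1983to89.B6GlobalChartV1L0 (blkV1)
open Literature.MathematicalPhysics.QuantumFieldTheory.Balaban1983to89.B6Geom246MultiLevelTorusL0 (geomT)
open Literature.MathematicalPhysics.QuantumFieldTheory.Balaban1983to89.B6Prop26KLevelSkeletonV1L0 (pref)
open Literature.MathematicalPhysics.QuantumFieldTheory.Balaban1983to89.B6GradLegKLevelV1 (DV)
open Literature.MathematicalPhysics.QuantumFieldTheory.Balaban1983to89.B6LapLegKLevelV1 (LapV)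
open Literature.MathematicalPhysics.QuantumFieldTheory.Balaban1983to89.B9CubeLettersOpsL0 (cubeFamY)
open Literature.MathematicalPhysics.QuantumFieldTheory.Balaban1983to89.B9CubeLettersBondOpsL0 (BlkCubeY deltaACubeY GACubeY)
open Literature.MathematicalPhysics.QuantumFieldTheory.Balaban1983to89.B9CubeBondWeights (domCube wCubeBond_pos)
open Literature.MathematicalPhysics.QuantumFieldTheory.Balaban1983to89.B9CubeLettersBondOpsAtOneIdentL0 (GACubeY_one_liftY deltaACubeY_one_mul_GACubeY_one
  GACubeY_one_mul_deltaACubeY_one)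
open Literature.MathematicalPhysics.QuantumFieldTheory.Balaban1983to89.B9Thm33CubeAtOne (thm33_cube_atOne_G)
open Literature.MathematicalPhysics.QuantumFieldTheory.Balaban1983to89.B9CubeGeometryInputs (geoCK geoCK_len geoCK_eta geoCK_eta_pos geoCK_dist geoCK_dist_axioms)
open Literature.MathematicalPhysics.QuantumFieldTheory.Balaban1983to89.B9Cor35GpCubeInputsAtOne (hasMajorant_conj_of_liftY hasMajorant_toB6_of_geomT conj_one')
open Literature.MathematicalPhysics.QuantumFieldTheory.Balaban1983to89.B9Eq359CubeKernelsAtOne (isUnit_of_conj_laws)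
open Literature.MathematicalPhysics.QuantumFieldTheory.Balaban1983to89.Node00 (SiteY CfgY SiteParY BondParY FBondY toKT liftY liftEndY liftEndY_liftY)
open scoped Matrix

variable {d ℓ : ℕ} {hd : 1 ≤ d + 1} {hL : Odd (ℓ + 1) ∧ 1 < ℓ + 1} {b₀ b₁ : ℝ}

/-! ## §1  The bond-sector cube letters at `U = 1` in real coordinates: `Δa = conj b(Δ_{a,□}(1))`, `G = conj b(G_□(1))`, `∇_ν`, `Δ`, the bond block map -/

section Letters

variable {𝔸 : Type} [NormedRing 𝔸] [NormedAlgebra ℂ 𝔸] [CompleteSpace 𝔸]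
variable {ι : Type} [Fintype ι] (b : Module.Basis ι ℝ 𝔸)
variable (i : KIdx d ℓ hd hL b₀ b₁) (q : ↥(cubes (toKT i).D.toDomains)) (parS : SiteParY 𝔸 i) (parB : BondParY 𝔸 i)

/-- **THE BOND BLOCK MAP of the cube sequence**: a fine bond `f` belongs to the cube block of its initial point `f₋` ([4]: «Ω also the set of bonds»;
the V1 lineage's `blkV1`), read through the first factor of the real coordinates. [cite: Balaban1984PropagatorsII, p.224, (2.51) p.232; Balaban1985BackgroundPropagators, p.408] -/
abbrev blkBK : FBondY i × ι → BlkCubeY i q := fun p => blkV1 i.hN (cubeFamY i q) p.1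

/-- **the letter `Δa = Δ_{a,□}(1)`** of the `G`-clause at the cube (r05's `deltaACubeY … 1` = the lift of [4]'s typed `Δ_a` of the cube sequence, continuum units
built in through `c_f = η⁻¹`), real coordinates. [cite: Balaban1985BackgroundPropagators, (3.26) p.395 («It coincides with Δ_a in (2.19) if U = 1»), Cor. 3.5 p.407, p.409 l.1–5] -/
def DaK : Module.End ℝ (FBondY i × ι → ℝ) := conj b ((deltaACubeY i q parS parB (fun _ _ => 1)).restrictScalars ℝ)

/-- **the letter `G = G_□(1) = Δ_{a,□}(1)⁻¹`** of the `G`-clause at the cube, real coordinates. [cite: Balaban1985BackgroundPropagators, (3.27) p.395, Thm 3.3 p.399, Cor. 3.5 p.407, p.409 l.1–5] -/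
def GK : Module.End ℝ (FBondY i × ι → ℝ) := conj b ((GACubeY i q parS parB (fun _ _ => 1)).restrictScalars ℝ)

/-- **the realified cube letter `Δ_{a,□}(V)` at any background** (the operator whose invertibility Cor. 3.5∕3.6 is about). [cite: Balaban1985BackgroundPropagators, (3.26) p.395, p.409 l.1–5] -/
def DaVK (V : CfgY 𝔸 i) : Module.End ℝ (FBondY i × ι → ℝ) := conj b ((deltaACubeY i q parS parB V).restrictScalars ℝ)

/-- **the flat covariant derivative `∇_ν` of bond functions at `U = 1`** in continuum units (`c_f·(shift − 1)`, the V1 lineage's `DV ν c_f`), lifted to `𝔸` and realified —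
the letter of Theorem 3.3's (3.42)₂-entry `∇G`. [cite: Balaban1985BackgroundPropagators, (3.3) p.390, (3.42) p.397, Cor. 3.5 p.407; Balaban1984PropagatorsII, (2.136) p.247] -/
def DK (ν : Fin (d + 1)) : Module.End ℝ (FBondY i × ι → ℝ) := conj b ((liftEndY 𝔸 (DV (P := B6GlobalChartV1.PV d ℓ i.m i.K hd hL) ν i.cf)).restrictScalars ℝ)

/-- **the flat covariant Laplacian `Δ` of bond functions at `U = 1`** in continuum units (the V1 lineage's `LapV c_f`), lifted and realified — the letter of (3.42)₄'s
entry `ΔG`. [cite: Balaban1985BackgroundPropagators, (3.42) p.397, Cor. 3.5 p.407; Balaban1984PropagatorsII, (2.136) p.247] -/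
def LapK : Module.End ℝ (FBondY i × ι → ℝ) := conj b ((liftEndY 𝔸 (LapV (P := B6GlobalChartV1.PV d ℓ i.m i.K hd hL) i.cf)).restrictScalars ℝ)

/-- ★ **THE BINDERS `hΔG`, `hGΔ` OF THE `G`-STEP AT THE CUBE**: `Δa·G = 1 = G·Δa` at `U = 1` (r05's `deltaACubeY_one_mul_GACubeY_one` ∕ `GACubeY_one_mul_deltaACubeY_one`, any
transporter letters with `parS 1 = 1`, `parB 1 = 1`). [cite: Balaban1985BackgroundPropagators, (3.27) p.395, Thm 3.3 p.399, Cor. 3.5 p.407, p.409 l.1–5] -/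
theorem DaK_mul_GK (hb₀ : 0 < b₀) (hparS : ∀ z w, parS (fun _ _ => 1) z w = 1) (hparB : ∀ s s', parB (fun _ _ => 1) s s' = 1) :
    DaK b i q parS parB * GK b i q parS parB = 1 ∧ GK b i q parS parB * DaK b i q parS parB = 1 := by
  constructor
  · rw [DaK, GK, ← B9Eq352DivFormLetters.conj_mul, Module.End.mul_eq_comp, ← LinearMap.restrictScalars_comp, ← Module.End.mul_eq_comp,
      deltaACubeY_one_mul_GACubeY_one i q hb₀ hparS hparB]
    exact conj_one' b
  · rw [DaK, GK, ← B9Eq352DivFormLetters.conj_mul, Module.End.mul_eq_comp, ← LinearMap.restrictScalars_comp, ← Module.End.mul_eq_comp,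
      GACubeY_one_mul_deltaACubeY_one i q hb₀ hparS hparB]
    exact conj_one' b

/-- `Δa = Δ_{a,□}(1)` realified is `DaVK` at `V = 1`. [cite: Balaban1985BackgroundPropagators, (3.26) p.395, bookkeeping] -/
theorem DaK_eq_DaVK_one : DaK b i q parS parB = DaVK b i q parS parB (fun _ _ => 1) := rfl

/-- **(3.84) BOOKKEEPING**: with the remainder `V := Δ_{a,□}(1) − Δ_{a,□}(Ṽ)` realified, `Δa − V` is the realified `Δ_{a,□}(Ṽ)` — the operator inverted by the `G`-step's `GExt`.
[cite: Balaban1985BackgroundPropagators, (3.82)–(3.84) p.407 («Δ_a(U′U) = Δ_a(U) − V(A)»)] -/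
theorem DaK_sub_remainder (V : CfgY 𝔸 i) :
    DaK b i q parS parB - conj b ((deltaACubeY i q parS parB (fun _ _ => 1) - deltaACubeY i q parS parB V).restrictScalars ℝ) = DaVK b i q parS parB V := by
  have e : ((deltaACubeY i q parS parB (fun _ _ => 1) - deltaACubeY i q parS parB V).restrictScalars ℝ) =
      (deltaACubeY i q parS parB (fun _ _ => 1)).restrictScalars ℝ - (deltaACubeY i q parS parB V).restrictScalars ℝ :=
    LinearMap.ext fun _ => rfl
  rw [DaK, DaVK, ← B9Eq352DivFormLetters.conj_sub, e, sub_sub_cancel]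

/-- ★ **THE EXIT DOOR OF THE `G`-STEP**: a two-sided inverse of the realified `Δ_{a,□}(Ṽ)` makes r05's `Δ_{a,□}(Ṽ)` a unit (so `G_□(Ṽ) = GACubeY … Ṽ` is its genuine inverse)
— p33's `isUnit_of_conj_laws` at scale `1`. [cite: Balaban1985BackgroundPropagators, Thm 3.4 p.400, Cor. 3.5 p.407, (3.86) p.407, p.409 l.1–5] -/
theorem isUnit_deltaACubeY_of_laws (V : CfgY 𝔸 i) (Y : Module.End ℝ (FBondY i × ι → ℝ)) (h1 : DaVK b i q parS parB V * Y = 1)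
    (h2 : Y * DaVK b i q parS parB V = 1) : IsUnit (deltaACubeY i q parS parB V) := by
  refine isUnit_of_conj_laws b (deltaACubeY i q parS parB V) one_ne_zero Y ?_ ?_
  · rw [one_smul]; exact h1
  · rw [one_smul]; exact h2

end Letters

/-! ## §2  Theorem 3.3 at `U = 1` for `G = conj b(G_□(1))`: the (3.42)₁,₂,₄-type block majorants over `toB6 (geoCK i □)` from r05's `thm33_cube_atOne_G` -/

section Majorants

variable {𝔸 : Type} [NormedRing 𝔸] [NormedAlgebra ℂ 𝔸] [CompleteSpace 𝔸]
variable {ι : Type} [Fintype ι] (b : Module.Basis ι ℝ 𝔸)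
variable (i : KIdx d ℓ hd hL b₀ b₁) (q : ↥(cubes (toKT i).D.toDomains)) (parS : SiteParY 𝔸 i) (parB : BondParY 𝔸 i)

/-- `η = |c_f|⁻¹`. [cite: Balaban1984PropagatorsII, (2.1) p.224 («η = L^{−k}»), bookkeeping] -/
theorem kGeo_eta : (kGeo i).eta = |i.cf|⁻¹ := rfl

/-- the V1 lineage's prefactor `(Lⁿ∕c_f)²` is `(Lⁿη)²`, the squared length of the cube block. [cite: Balaban1985BackgroundPropagators, (3.41)–(3.42) p.397; Balaban1984PropagatorsII, (2.136) p.247, bookkeeping] -/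
theorem pref_eq_len_sq (y : BlkCubeY i q) : pref i.cf y = (geoCK i q).len y ^ 2 := by
  rw [geoCK_len, kGeo_eta, pref, div_pow, mul_pow, inv_pow, sq_abs, div_eq_mul_inv]
  push_cast
  ring

/-- the V1 lineage's `len_T(y)·|c_f|⁻¹` (lattice length × spacing) is the cube block's length `Lⁿη`. [cite: Balaban1985BackgroundPropagators, (3.41) p.397, bookkeeping] -/
theorem geomT_len_mul (y : BlkCubeY i q) : (geomT (cubeFamY i q)).len y * |i.cf|⁻¹ = (geoCK i q).len y := by
  rw [geoCK_len, kGeo_eta]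
  show ((ℓ : ℝ) + 1) ^ y.1.1 * 1 * |i.cf|⁻¹ = _
  rw [mul_one]

/-- `G_□(1)(J ⊗ E) = (G J) ⊗ E` for the realified letter's core (r05's `GACubeY_one_liftY`). [cite: Balaban1985BackgroundPropagators, (3.27) p.395, Cor. 3.5 p.407] -/
theorem GACubeY_one_restrict_liftY (hb₀ : 0 < b₀) (hparS : ∀ z w, parS (fun _ _ => 1) z w = 1) (hparB : ∀ s s', parB (fun _ _ => 1) s s' = 1)
    (J : FBondY i → ℝ) (E : 𝔸) :
    (GACubeY i q parS parB (fun _ _ => 1)).restrictScalars ℝ (liftY J E) = liftY (onFun (GE (domCube i q) i.hcf (wCubeBond_pos i q hb₀)) J) E := by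
  rw [LinearMap.restrictScalars_apply]
  exact GACubeY_one_liftY i q hb₀ hparS hparB J E

/-- ★★ **BINDER `hG` AT THE CUBE** ((3.42)₁-type entry of Theorem 3.3 for `G_□(1)`): from the V1 lineage's block majorant `G ≺ A·(Lⁿ∕c_f)²·e^{−δd}` over the cube
sequence's blocks, `conj b(G_□(1)) ≺ A·(Lⁿη)²·e^{−δd}` over `toB6 (geoCK i □)`. [cite: Balaban1985BackgroundPropagators, Thm 3.3 p.399, (3.42)₁ p.397, Cor. 3.5 p.407, p.409 l.1–5; Balaban1984PropagatorsII, Prop. 2.6 (2.136)₁ p.247, (2.51) p.232] -/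
theorem hG_cube (hb₀ : 0 < b₀) (hparS : ∀ z w, parS (fun _ _ => 1) z w = 1) (hparB : ∀ s s', parB (fun _ _ => 1) s s' = 1) {A δ : ℝ} (Rr : ℝ) (H : Prop)
    (h₁ : HasMajorant (g := geomT (cubeFamY i q)) (blkV1 i.hN (cubeFamY i q)) (onFun (GE (domCube i q) i.hcf (wCubeBond_pos i q hb₀)))
      (fun y y' => A * pref i.cf y * Real.exp (-(δ * (geomT (cubeFamY i q)).dist y y')))) :
    HasMajorant (g := toB6 (geoCK i q) Rr H) (blkBK i q) (GK b i q parS parB)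
      (fun a a' => A * (geoCK i q).len a ^ 2 * Real.exp (-(δ * (geoCK i q).dist a a'))) := by
  rw [GK]
  refine hasMajorant_mono (g := toB6 (geoCK i q) Rr H) _
    (hasMajorant_conj_of_liftY b (g := toB6 (geoCK i q) Rr H) (blkV1 i.hN (cubeFamY i q)) _ _
      (GACubeY_one_restrict_liftY i q parS parB hb₀ hparS hparB) (hasMajorant_toB6_of_geomT i q Rr H h₁)) fun a a' => ?_
  rw [pref_eq_len_sq]

/-- ★★ **BINDER `hDG` AT THE CUBE, DIRECTION `ν`** ((3.42)₂-type entry `∇_νG_□(1)`): from the V1 lineage's `∇_νG ≺ A·(len_T∕c_f)·e^{−δd}`, `conj b(∇_ν)·conj b(G_□(1)) ≺ A·(Lⁿη)·e^{−δd}`.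
[cite: Balaban1985BackgroundPropagators, Thm 3.3 p.399, (3.42)₂ p.397, Cor. 3.5 p.407; Balaban1984PropagatorsII, Prop. 2.6 (2.136)₂ p.247] -/
theorem hDG_cube (hb₀ : 0 < b₀) (hparS : ∀ z w, parS (fun _ _ => 1) z w = 1) (hparB : ∀ s s', parB (fun _ _ => 1) s s' = 1) {A δ : ℝ} (Rr : ℝ) (H : Prop)
    (ν : Fin (d + 1))
    (h₂ : HasMajorant (g := geomT (cubeFamY i q)) (blkV1 i.hN (cubeFamY i q))
      (DV ν i.cf ∘ₗ onFun (GE (domCube i q) i.hcf (wCubeBond_pos i q hb₀)))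
      (fun y y' => A * ((geomT (cubeFamY i q)).len y * |i.cf|⁻¹) * Real.exp (-(δ * (geomT (cubeFamY i q)).dist y y')))) :
    HasMajorant (g := toB6 (geoCK i q) Rr H) (blkBK i q) (DK b i ν * GK b i q parS parB)
      (fun a a' => A * (geoCK i q).len a * Real.exp (-(δ * (geoCK i q).dist a a'))) := by
  rw [DK, GK, ← B9Eq352DivFormLetters.conj_mul]
  have hT : ∀ (J : FBondY i → ℝ) (E : 𝔸),
      ((liftEndY 𝔸 (DV (P := B6GlobalChartV1.PV d ℓ i.m i.K hd hL) ν i.cf)).restrictScalars ℝ * (GACubeY i q parS parB (fun _ _ => 1)).restrictScalars ℝ)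
          (liftY J E) =
        liftY ((DV ν i.cf ∘ₗ onFun (GE (domCube i q) i.hcf (wCubeBond_pos i q hb₀))) J) E := by
    intro J E
    rw [Module.End.mul_apply, GACubeY_one_restrict_liftY i q parS parB hb₀ hparS hparB, LinearMap.restrictScalars_apply, liftEndY_liftY,
      LinearMap.comp_apply]
  refine hasMajorant_mono (g := toB6 (geoCK i q) Rr H) _
    (hasMajorant_conj_of_liftY b (g := toB6 (geoCK i q) Rr H) (blkV1 i.hN (cubeFamY i q)) _ _ hT (hasMajorant_toB6_of_geomT i q Rr H h₂)) fun a a' => ?_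
  rw [geomT_len_mul]

/-- ★★ **BINDER FOR THE (3.42)₄-TYPE ENTRY `ΔG_□(1)`**: from the V1 lineage's `ΔG ≺ A·e^{−δd}`, `conj b(Δ)·conj b(G_□(1)) ≺ A·e^{−δd}`.
[cite: Balaban1985BackgroundPropagators, Thm 3.3 p.399, (3.42) p.397, Cor. 3.5 p.407; Balaban1984PropagatorsII, Prop. 2.6 (2.136)₃ p.247] -/
theorem hLapG_cube (hb₀ : 0 < b₀) (hparS : ∀ z w, parS (fun _ _ => 1) z w = 1) (hparB : ∀ s s', parB (fun _ _ => 1) s s' = 1) {A δ : ℝ} (Rr : ℝ) (H : Prop)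
    (h₃ : HasMajorant (g := geomT (cubeFamY i q)) (blkV1 i.hN (cubeFamY i q))
      (LapV i.cf ∘ₗ onFun (GE (domCube i q) i.hcf (wCubeBond_pos i q hb₀)))
      (fun y y' => A * Real.exp (-(δ * (geomT (cubeFamY i q)).dist y y')))) :
    HasMajorant (g := toB6 (geoCK i q) Rr H) (blkBK i q) (LapK b i * GK b i q parS parB)
      (fun a a' => A * Real.exp (-(δ * (geoCK i q).dist a a'))) := by
  rw [LapK, GK, ← B9Eq352DivFormLetters.conj_mul]
  have hT : ∀ (J : FBondY i → ℝ) (E : 𝔸),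
      ((liftEndY 𝔸 (LapV (P := B6GlobalChartV1.PV d ℓ i.m i.K hd hL) i.cf)).restrictScalars ℝ * (GACubeY i q parS parB (fun _ _ => 1)).restrictScalars ℝ)
          (liftY J E) =
        liftY ((LapV i.cf ∘ₗ onFun (GE (domCube i q) i.hcf (wCubeBond_pos i q hb₀))) J) E := by
    intro J E
    rw [Module.End.mul_apply, GACubeY_one_restrict_liftY i q parS parB hb₀ hparS hparB, LinearMap.restrictScalars_apply, liftEndY_liftY,
      LinearMap.comp_apply]
  exact hasMajorant_conj_of_liftY b (g := toB6 (geoCK i q) Rr H) (blkV1 i.hN (cubeFamY i q)) _ _ hT (hasMajorant_toB6_of_geomT i q Rr H h₃)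

/-- ★★★ **THEOREM 3.3 AT `U = 1` FOR THE REALIFIED CUBE LETTER `G = conj b(G_□(1))`, ALL MEMBERS AND CUBES, ONE SET OF CONSTANTS** (Cor. 3.5's input «with U = 1,
these theorems were proved in [4]»): for `0 < b₀ ≤ b₁` there is `σ₁ > 0` and, for every `0 < σ ≤ σ₁`, `0 < α ≤ 1`, constants `A ≥ 0`, `M₂ > 0` such that for every
member `i` above the threshold `M₂ ≤ L·M_h`, every cover cube `□`, every `Rr, H`, every real basis `b` of `𝔸` and all transporter letters with `parS 1 = 1`,
`parB 1 = 1`: `G ≺ A(Lⁿη)²e^{−δ₃d}`, `∇_νG ≺ A(Lⁿη)e^{−δ₃d}` (all `ν`), `ΔG ≺ Ae^{−δ₃d}` over `toB6 (geoCK i □) Rr H`, `δ₃ = delta3 α (2σ)` — r05's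
`thm33_cube_atOne_G` ([4] Prop. 2.6 (2.136) for the cube sequence) read through §2.
[cite: Balaban1985BackgroundPropagators, Thm 3.3 p.399, (3.42) p.397, Cor. 3.5 p.407, p.409 l.1–5; Balaban1984PropagatorsII, Prop. 2.6 (2.136) p.247] -/
theorem thm33_GK_cube (hb₀ : 0 < b₀) (hb₁ : b₀ ≤ b₁) :
    ∃ σ₁ : ℝ, 0 < σ₁ ∧ ∀ (σ : ℝ), 0 < σ → σ ≤ σ₁ → ∀ (α : ℝ), 0 < α → α ≤ 1 →
    ∃ A M₂ : ℝ, 0 ≤ A ∧ 0 < M₂ ∧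
    ∀ (i : KIdx d ℓ hd hL b₀ b₁) (q : ↥(cubes (toKT i).D.toDomains)) (Rr : ℝ) (H : Prop) (parS : SiteParY 𝔸 i) (parB : BondParY 𝔸 i),
      (∀ z w, parS (fun _ _ => 1) z w = 1) → (∀ s s', parB (fun _ _ => 1) s s' = 1) → M₂ ≤ ((ℓ : ℝ) + 1) * i.Mh →
      HasMajorant (g := toB6 (geoCK i q) Rr H) (blkBK i q) (GK b i q parS parB)
        (fun a a' => A * (geoCK i q).len a ^ 2 * Real.exp (-(delta3 α (2 * σ) * (geoCK i q).dist a a'))) ∧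
      (∀ ν : Fin (d + 1), HasMajorant (g := toB6 (geoCK i q) Rr H) (blkBK i q) (DK b i ν * GK b i q parS parB)
        (fun a a' => A * (geoCK i q).len a * Real.exp (-(delta3 α (2 * σ) * (geoCK i q).dist a a')))) ∧
      HasMajorant (g := toB6 (geoCK i q) Rr H) (blkBK i q) (LapK b i * GK b i q parS parB)
        (fun a a' => A * Real.exp (-(delta3 α (2 * σ) * (geoCK i q).dist a a'))) := by
  obtain ⟨σ₁, hσ₁, h⟩ := thm33_cube_atOne_G (d := d) (ℓ := ℓ) (hd := hd) (hL := hL) hb₀ hb₁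
  refine ⟨σ₁, hσ₁, fun σ hσ hσ1 α hα hα1 => ?_⟩
  obtain ⟨A, M₂, hA, hM₂, h2⟩ := h σ hσ hσ1 α hα hα1
  refine ⟨A, M₂, hA, hM₂, fun i q Rr H parS parB hparS hparB hM => ?_⟩
  obtain ⟨h₁, h₂, h₃⟩ := h2 i q hM
  exact ⟨hG_cube b i q parS parB hb₀ hparS hparB Rr H h₁, fun ν => hDG_cube b i q parS parB hb₀ hparS hparB Rr H ν (h₂ ν),
    hLapG_cube b i q parS parB hb₀ hparS hparB Rr H h₃⟩

end Majorants

/-! ## §3  ★★★ Cor. 3.5 ∕ Thm 3.4 `G`-STEP AT THE CUBE LETTERS, MODULO THE (3.85)-MAJORANT: `IsUnit Δ_{a,□}(Ṽ)`, `conj b(G_□(Ṽ))` is the Neumann inverse, its (3.42)-entries -/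

section GStep

variable {𝔸 : Type} [NormedRing 𝔸] [NormedAlgebra ℂ 𝔸] [CompleteSpace 𝔸]
variable {ι : Type} [Fintype ι] (b : Module.Basis ι ℝ 𝔸)
variable (i : KIdx d ℓ hd hL b₀ b₁) (q : ↥(cubes (toKT i).D.toDomains)) (parS : SiteParY 𝔸 i) (parB : BondParY 𝔸 i)

/-- **the realified cube letter `G_□(V) = Δ_{a,□}(V)⁻¹`** (r05's `Ring.inverse` letter) at any background. [cite: Balaban1985BackgroundPropagators, (3.27) p.395, p.409 l.1–5] -/
def GVK (V : CfgY 𝔸 i) : Module.End ℝ (FBondY i × ι → ℝ) := conj b ((GACubeY i q parS parB V).restrictScalars ℝ)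

/-- **the realified (3.84) remainder `V(A) = Δ_{a,□}(1) − Δ_{a,□}(Ṽ)`** of r05's letters. [cite: Balaban1985BackgroundPropagators, (3.82)–(3.84) p.407] -/
def VK (V : CfgY 𝔸 i) : Module.End ℝ (FBondY i × ι → ℝ) :=
  conj b ((deltaACubeY i q parS parB (fun _ _ => 1) - deltaACubeY i q parS parB V).restrictScalars ℝ)

/-- `Δa − V = Δ_{a,□}(Ṽ)` realified. [cite: Balaban1985BackgroundPropagators, (3.84) p.407] -/
theorem DaK_sub_VK (V : CfgY 𝔸 i) : DaK b i q parS parB - VK b i q parS parB V = DaVK b i q parS parB V := DaK_sub_remainder b i q parS parB V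

/-- once `Δ_{a,□}(Ṽ)` is a unit, `conj b(G_□(Ṽ))` inverts `conj b(Δ_{a,□}(Ṽ))` on both sides. [cite: Balaban1985BackgroundPropagators, (3.27) p.395, bookkeeping] -/
theorem DaVK_mul_GVK {V : CfgY 𝔸 i} (hU : IsUnit (deltaACubeY i q parS parB V)) :
    DaVK b i q parS parB V * GVK b i q parS parB V = 1 ∧ GVK b i q parS parB V * DaVK b i q parS parB V = 1 := by
  constructor
  · rw [DaVK, GVK, ← B9Eq352DivFormLetters.conj_mul, Module.End.mul_eq_comp, ← LinearMap.restrictScalars_comp, ← Module.End.mul_eq_comp,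
      B9CubeLettersBondOpsL0.deltaACubeY_mul_GACubeY i q hU]
    exact conj_one' b
  · rw [DaVK, GVK, ← B9Eq352DivFormLetters.conj_mul, Module.End.mul_eq_comp, ← LinearMap.restrictScalars_comp, ← Module.End.mul_eq_comp,
      B9CubeLettersBondOpsL0.GACubeY_mul_deltaACubeY i q hU]
    exact conj_one' b

/-- ★★★ **THE `G`-STEP OF THEOREM 3.4 ∕ COR. 3.5 AT THE CUBE LETTERS, MODULO THE (3.85)-MAJORANT** («Δ_a(U′U) = Δ_a(U) − V(A) = (I − V(A)G(U))Δ_a(U) … V(A)G(U) is a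
small operator … G(U′U) = G(U)(I − V(A)G(U))⁻¹ = Σ G(U)(V(A)G(U))ⁿ», p. 407, at `U = 1` for the cube sequence, Cor. 3.5): IF the realified remainder times
`G_□(1)` has the (3.85)-majorant `V·G ≺ θe^{−ρd}` over `toB6 (geoCK i □)` (`h385` — the analytic content, (3.73)∕(3.77)∕(3.83) at r05's letters through r06's
`B9Ineq385VG.ineq385_op`; NOT proved here), [4] Lemma 2.1 holds at `(ρ, α′)` and `θc₁(α′) < 1`, THEN: (i) `Δ_{a,□}(Ṽ)` is a unit (so r05's `G_□(Ṽ) = GACubeY … Ṽ` is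
its genuine inverse); (ii) `conj b(G_□(Ṽ))` satisfies both resolvent identities of (3.86); (iii) every LEFT entry `X·G_□(1) ≺ B₀P(y)e^{−ρd}` (`P ≧ 0`; `X = 1`,
`∇_ν`, `Δ` by §2) transfers to `X·G_□(Ṽ) ≺ B₀c₁(α′)(1 − θc₁(α′))⁻¹P(y)e^{−(1−α′)ρd}` — r06's abstract `exists_gExt_of_385` ∕ `gExt_leftEntry_of_386` at these letters,
uniqueness of the two-sided inverse. [cite: Balaban1985BackgroundPropagators, Thm 3.4 p.400, Cor. 3.5 p.407, (3.84)–(3.86) p.407, Thm 3.3 p.399, (3.42) p.397, p.409 l.1–5; Balaban1984PropagatorsII, Lemma 2.1 p.234, (2.66) p.234] -/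
theorem gStep_cube (hb₀ : 0 < b₀) (hparS : ∀ z w, parS (fun _ _ => 1) z w = 1) (hparB : ∀ s s', parB (fun _ _ => 1) s s' = 1)
    (Rr : ℝ) (H : Prop) (dB : ℕ) {ρ α' θ : ℝ} (hθ : 0 ≤ θ) (hρ : 0 ≤ ρ) (hα' : α' ≤ 1) (hα'ρ : 0 ≤ (1 - α') * ρ)
    (h261 : B6RandomWalk.Ineq261 dB (toB6 (geoCK i q) Rr H) ρ α') (hsmall : θ * B6.c1 dB ρ α' < 1) (V : CfgY 𝔸 i)
    (h385 : HasMajorant (g := toB6 (geoCK i q) Rr H) (blkBK i q) (VK b i q parS parB V * GK b i q parS parB)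
      (fun a a' => θ * Real.exp (-(ρ * (geoCK i q).dist a a')))) :
    IsUnit (deltaACubeY i q parS parB V) ∧
    (GVK b i q parS parB V = GK b i q parS parB + GK b i q parS parB * VK b i q parS parB V * GVK b i q parS parB V ∧
      GVK b i q parS parB V = GK b i q parS parB + GVK b i q parS parB V * (VK b i q parS parB V * GK b i q parS parB)) ∧
    ∀ (X : Module.End ℝ (FBondY i × ι → ℝ)) (B₀ : ℝ) (P : BlkCubeY i q → ℝ), 0 ≤ B₀ → (∀ y, 0 ≤ P y) →
      HasMajorant (g := toB6 (geoCK i q) Rr H) (blkBK i q) (X * GK b i q parS parB)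
        (fun a a' => B₀ * P a * Real.exp (-(ρ * (geoCK i q).dist a a'))) →
      HasMajorant (g := toB6 (geoCK i q) Rr H) (blkBK i q) (X * GVK b i q parS parB V)
        (fun a a' => B₀ * B6.c1 dB ρ α' * (1 - θ * B6.c1 dB ρ α')⁻¹ * P a * Real.exp (-((1 - α') * ρ * (geoCK i q).dist a a'))) := by
  classical
  obtain ⟨hdnn, htri, hrefl, -⟩ := geoCK_dist_axioms i q Rr H
  obtain ⟨hΔG, hGΔ⟩ := DaK_mul_GK b i q parS parB hb₀ hparS hparB
  -- (3.86): the Neumann inverse of `Δa − V` exists (r06's abstract step)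
  obtain ⟨GExt, h386a, h386b, hinvL, hinvR⟩ := B9Ineq385VG.exists_gExt_of_385 (R := Rr) (H := H) (blkBK i q) dB ρ α' θ hθ hα'ρ hdnn h261 hsmall
    (DaK b i q parS parB) (GK b i q parS parB) (VK b i q parS parB V) hΔG hGΔ h385
  rw [DaK_sub_VK] at hinvL hinvR
  -- (i) the unit
  have hU : IsUnit (deltaACubeY i q parS parB V) := isUnit_deltaACubeY_of_laws b i q parS parB V GExt hinvL hinvR
  -- uniqueness of the two-sided inverse: `GExt = conj b(G_□(Ṽ))`
  obtain ⟨h1, -⟩ := DaVK_mul_GVK b i q parS parB hU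
  have hEq : GExt = GVK b i q parS parB V := by
    calc GExt = GExt * (DaVK b i q parS parB V * GVK b i q parS parB V) := by rw [h1, mul_one]
      _ = GVK b i q parS parB V := by rw [← mul_assoc, hinvR, one_mul]
  subst hEq
  refine ⟨hU, ⟨h386a, h386b⟩, fun X B₀ P hB₀ hP hX => ?_⟩
  exact B9Ineq385VG.gExt_leftEntry_of_386 (R := Rr) (H := H) (blkBK i q) dB ρ α' θ B₀ P hB₀ hP hθ hρ hα' hα'ρ htri hrefl hdnn h261 hsmall hX h385 h386b

end GStep

end Literature.MathematicalPhysics.QuantumFieldTheory.Balaban1983to89.B9Cor35GCubeInputsAtOne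

end
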